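import Summits.ValiantsHypothesis.ValiantsHypothesis.Theorems.ValuativeGCTValuativeFlipDetEffectiveMonotoneRay
import Summits.ValiantsHypothesis.ValiantsHypothesis.Theorems.ValuativeGCTValuativeFlipPerAnchorInheritanceEvery
import Summits.ValiantsHypothesis.ValiantsHypothesis.Theorems.ValuativeGCTValuativeFlipTwistPositivityTransfer
import HarnessLib

/-!
# `ValuativeGCT.ValuativeFlip` (stmt-ValiantsHypothesis-12624): Kadish–Landsberg rays at EVERY padding —
# the threshold-free form of the ray theory after twist positivity

Wall-breaker k4 (gen 1, seat 3; axis "representation-stability transfer between `m` and `m + 1`"),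
helper file `--supports stmt-ValiantsHypothesis-12624`.

Letters: inner size `n ≥ 1`, degree `δ`, inner shape `μ ⊢ nδ` with at most `n²` parts, padding `j`,
level `n + j`, ray shape `μ♯(n+j) = rowLift μ j`; `P(j) := mult_{(μ♯)*} ℂ[Δ_{n+j}(X₀₀^j per_n)]`
(per side), `K(j) := mult_{(μ♯)*} ℂ[Δ(det_{n+j})]` (det side), `a(j) := a_{μ♯}(δ[n+j])` (ambient
plethysm coefficient; `a(j) = a(0)` when `μ₂ ≤ n`, `plethysmCoeff_rowLift_eq`).

State of the axis BEFORE twist positivity (k4 gen0/gen1 s1–s2, k12 gen0, k16 gen0–gen1 s3): every transfer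
along the ray was EVENTUAL — `P(0) ≤ P(j)` off finitely many `j`, `K(0) ≤ K(j)` for `j ≥ 2(n+1)^10`
(`det_paddingMonotone`), and the ray theorems of `…DetEffectiveMonotoneRay.lean` all carry that threshold.
Twist positivity (k12 gen1, `perAnchorInheritance_every`, `det_everyStepMonotone`: BLMW 2011 Problem 6.10 "≥"
at EVERY padding, by the unitarian trick) removes every threshold.  This file records the resulting FINAL
form of the ray theory, which is what the tail programme quotes:

* `det_ray_mono` — `K(j₁) ≤ K(j₂)` for ALL `j₁ ≤ j₂` (the det side never decays along a ray);
* `det_ray_eq_plethysm_of_eqFree_base_every`, `det_base_lt_plethysm_of_ray_lt_every` — equation-freeness of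
  `Det_n` at `(μ, δ)` (`μ₂ ≤ n`) propagates to `Det_{n+j}` at `(μ♯, δ)` for EVERY `j`; equivalently an equation
  of `Det_{n+j}` of a row-lifted type DESCENDS to `Det_n`;
* `per_ray_eq_plethysm_of_eqFree_base`, `per_base_lt_plethysm_of_ray_lt` — the same two statements for the
  padded PERMANENT: if `Δ_n(per_n)` has no equation of type `μ*` in degree `δ` then NO padded orbit closure
  `Δ_{n+j}(X₀₀^j per_n)` has one of type `(μ♯)*`, and `P(j) = a(j)` is the full plethysm coefficient at every
  padding; an equation of a padded permanent of row-lifted type descends to the permanent itself;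
* `paddedPer_le_det_ray_of_eqFree_base_every` — **no multiplicity flip anywhere on the ray of a
  `Det_n`-equation-free inner type**: for every `j` and every inner size `n' ≤ n + j`,
  `mult_{(μ♯)*} ℂ[Δ_{n+j}(X₀₀^{n+j-n'} per_{n'})] ≤ K(j)` (`= a(j)`).  With the route's PROVED `ValuativeBound`
  (`dim T_U(λ) ≥ K_m(λ*)`) this kills the body of `ValuativeFlip` at the shape `μ♯(n+j)` for every admissible
  `(U, r)`: tail witnesses on Kadish–Landsberg rays with `μ₂ ≤ n` need the inner shape `μ` to be the TYPE OF AN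
  EQUATION of the inner determinant `Det_n` in degree `δ` — at every padding, not only beyond `2(n+1)^10`.

Sources: BLMW, SIAM J. Comput. 40 (2011) §4.4, §6.4 (Problem 6.10); Kadish–Landsberg, Commun. Algebra 42 (2014);
Bürgisser–Ikenmeyer–Panova, J. AMS 32 (2019) Prop. 5.6(2); this crux: k12 gen1 (twist positivity),
k16 gen1 s3 (effective det ray), k4 gen1 s2 (exact inner plethysm stability).
-/

set_option linter.dupNamespace false

namespace Summit.ValiantsHypothesis.ValiantsHypothesis.Theorems.ValuativeFlip

open scoped BigOperators
open MvPolynomial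
open Literature.NumberTheory.DiophantineGeometry
open Literature.Computability.AlgebraicComplexity
open Literature.Computability.Complexity

noncomputable section

/-! ## The determinant side at every padding -/

/-- **The determinant's ray is monotone at EVERY step**: for `μ ⊢ nδ` (`≤ n²` parts) and all `j₁ ≤ j₂`,
`K(j₁) ≤ K(j₂)` — `det_everyStepMonotone` at level `n + j₁` for the shape `μ♯(n+j₁)`, and
`(μ♯(n+j₁))♯ = μ♯(n+j₂)`.  Threshold-free form of `det_ray_mono_of_le`.
[BLMW 2011 Problem 6.10 (det half); this crux, k12 gen1 + k16] -/
theorem det_ray_mono (n δ : ℕ) [NeZero n] (μ : Nat.Partition (n * δ)) (hμ : μ.parts.card ≤ n * n)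
    {j₁ j₂ : ℕ} [NeZero (n + j₁)] [NeZero (n + j₂)] (h : j₁ ≤ j₂) :
    orbitMultiplicity ℂ (detFormLex ℂ (n + j₁)) (n + j₁) (partitionWeightLex (n + j₁) (rowLift μ j₁)) ≤
      orbitMultiplicity ℂ (detFormLex ℂ (n + j₂)) (n + j₂) (partitionWeightLex (n + j₂) (rowLift μ j₂)) := by
  obtain ⟨j, rfl⟩ := Nat.exists_eq_add_of_le h
  haveI : NeZero (n + j₁ + j) := ⟨by have := NeZero.ne n; omega⟩
  have h1 := det_everyStepMonotone (n + j₁) δ (rowLift μ j₁) (card_parts_rowLift_le_sq μ hμ j₁) j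
  rwa [orbitMultiplicity_det_congr_level (m₂ := n + (j₁ + j)) (Nat.add_assoc n j₁ j)
    (rowLift (rowLift μ j₁) j) (rowLift μ (j₁ + j)) (parts_rowLift_rowLift μ j₁ j)] at h1

/-- **Equation-freeness of the inner determinant propagates up the ray at EVERY padding.**  If `Det_n`
has no equation of type `μ*` in degree `δ` (`a_μ(δ[n]) ≤ K_n(μ*)`) and `μ₂ ≤ n`, then for every `j`
`K(j) = a(j)`: `Det_{n+j}` has no equation of type `(μ♯(n+j))*` in degree `δ`.
Proof: `K(j) ≤ a(j) = a(0) ≤ K(0) ≤ K(j)`.  Threshold-free form of `det_ray_eq_plethysm_of_eqFree_base`.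
[BLMW 2011 §6.4; Bürgisser–Ikenmeyer–Panova 2019 Prop. 5.6(2); this crux, k4 + k12 + k16] -/
theorem det_ray_eq_plethysm_of_eqFree_base_every (n δ : ℕ) [NeZero n] (μ : Nat.Partition (n * δ))
    (hμ : μ.parts.card ≤ n * n) (h₂ : μ.sortedParts.getD 1 0 ≤ n)
    (hfree : plethysmCoeff ℂ (MatIdx n) n (partitionWeightLex n μ) ≤
      orbitMultiplicity ℂ (detFormLex ℂ n) n (partitionWeightLex n μ))
    (j : ℕ) [NeZero (n + j)] :
    orbitMultiplicity ℂ (detFormLex ℂ (n + j)) (n + j) (partitionWeightLex (n + j) (rowLift μ j)) =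
      plethysmCoeff ℂ (MatIdx (n + j)) (n + j) (partitionWeightLex (n + j) (rowLift μ j)) := by
  apply le_antisymm
  · exact orbitMultiplicity_le_plethysmCoeff_holds _ (NeZero.ne (n + j)) (detFormLex_isHomogeneous ℂ (n + j)) _
  · rw [plethysmCoeff_rowLift_eq μ hμ h₂ j]
    exact hfree.trans (det_everyStepMonotone n δ μ hμ j)

/-- **Equations of row-lifted type descend to the inner determinant, from EVERY level**: if `μ₂ ≤ n` and
`Det_{n+j}` has an equation of type `(μ♯(n+j))*` in degree `δ` (`K(j) < a(j)`), then `Det_n` has one of type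
`μ*` in degree `δ` (`K_n(μ*) < a_μ(δ[n])`).  Threshold-free form of `det_base_lt_plethysm_of_ray_lt`.
[this crux, k4 + k12 + k16] -/
theorem det_base_lt_plethysm_of_ray_lt_every (n δ : ℕ) [NeZero n] (μ : Nat.Partition (n * δ))
    (hμ : μ.parts.card ≤ n * n) (h₂ : μ.sortedParts.getD 1 0 ≤ n) (j : ℕ) [NeZero (n + j)]
    (hlt : orbitMultiplicity ℂ (detFormLex ℂ (n + j)) (n + j) (partitionWeightLex (n + j) (rowLift μ j)) <
      plethysmCoeff ℂ (MatIdx (n + j)) (n + j) (partitionWeightLex (n + j) (rowLift μ j))) :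
    orbitMultiplicity ℂ (detFormLex ℂ n) n (partitionWeightLex n μ) <
      plethysmCoeff ℂ (MatIdx n) n (partitionWeightLex n μ) := by
  by_contra hge
  rw [not_lt] at hge
  exact (lt_irrefl _) (hlt.trans_le (le_of_eq (det_ray_eq_plethysm_of_eqFree_base_every n δ μ hμ h₂ hge j).symm))

/-! ## The permanent side at every padding -/

/-- **Equation-freeness of the PERMANENT propagates up its padded ray at every padding.**  If `Δ_n(per_n)`
has no equation of type `μ*` in degree `δ` (`a_μ(δ[n]) ≤ P_n(μ)`) and `μ₂ ≤ n`, then for every `j` the padded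
orbit closure `Δ_{n+j}(X₀₀^j per_n)` has no equation of type `(μ♯(n+j))*` in degree `δ`: `P(j) = a(j)`, the
full ambient plethysm coefficient.  Proof: `P(j) ≤ a(j) = a(0) ≤ P(0) ≤ P(j)`, the last step being twist
positivity `perAnchorInheritance_every`.  (So HWV-equation hunting for padded permanents on row-lifted
types reduces entirely to the UNPADDED permanent.) [BLMW 2011 Problem 6.10; this crux, k4 + k12] -/
theorem per_ray_eq_plethysm_of_eqFree_base (n δ : ℕ) [NeZero n] (μ : Nat.Partition (n * δ))
    (hμ : μ.parts.card ≤ n * n) (h₂ : μ.sortedParts.getD 1 0 ≤ n)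
    (hfree : plethysmCoeff ℂ (MatIdx n) n (partitionWeightLex n μ) ≤
      orbitMultiplicity ℂ (paddedPerFormLex ℂ n n) n (partitionWeightLex n μ))
    (j : ℕ) [NeZero (n + j)] :
    orbitMultiplicity ℂ (paddedPerFormLex ℂ n (n + j)) (n + j) (partitionWeightLex (n + j) (rowLift μ j)) =
      plethysmCoeff ℂ (MatIdx (n + j)) (n + j) (partitionWeightLex (n + j) (rowLift μ j)) := by
  apply le_antisymm
  · exact orbitMultiplicity_le_plethysmCoeff_holds _ (NeZero.ne (n + j))
      (paddedPerFormLex_isHomogeneous ℂ (Nat.le_add_right n j)) _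
  · rw [plethysmCoeff_rowLift_eq μ hμ h₂ j]
    exact hfree.trans (perAnchorInheritance_every n j δ μ hμ)

/-- **Equations of padded permanents of row-lifted type descend to the permanent**: if `μ₂ ≤ n` and
`Δ_{n+j}(X₀₀^j per_n)` has an equation of type `(μ♯(n+j))*` in degree `δ` (`P(j) < a(j)`), then `Δ_n(per_n)`
has one of type `μ*` in degree `δ` (`P_n(μ) < a_μ(δ[n])`). [BLMW 2011 Problem 6.10; this crux, k4 + k12] -/
theorem per_base_lt_plethysm_of_ray_lt (n δ : ℕ) [NeZero n] (μ : Nat.Partition (n * δ))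
    (hμ : μ.parts.card ≤ n * n) (h₂ : μ.sortedParts.getD 1 0 ≤ n) (j : ℕ) [NeZero (n + j)]
    (hlt : orbitMultiplicity ℂ (paddedPerFormLex ℂ n (n + j)) (n + j) (partitionWeightLex (n + j) (rowLift μ j)) <
      plethysmCoeff ℂ (MatIdx (n + j)) (n + j) (partitionWeightLex (n + j) (rowLift μ j))) :
    orbitMultiplicity ℂ (paddedPerFormLex ℂ n n) n (partitionWeightLex n μ) <
      plethysmCoeff ℂ (MatIdx n) n (partitionWeightLex n μ) := by
  by_contra hge
  rw [not_lt] at hge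
  exact (lt_irrefl _) (hlt.trans_le (le_of_eq (per_ray_eq_plethysm_of_eqFree_base n δ μ hμ h₂ hge j).symm))

/-! ## No flip anywhere on the ray of a `Det_n`-equation-free inner type -/

/-- **No multiplicity flip at ANY padding on the ray of an equation-free inner type, against every padded
permanent.**  If `Det_n` has no equation of type `μ*` in degree `δ` and `μ₂ ≤ n`, then for EVERY `j` and
every inner size `n' ≤ n + j`: `mult_{(μ♯)*} ℂ[Δ_{n+j}(X₀₀^{n+j-n'} per_{n'})] ≤ K(j)` (plethysm bound
`≤ a(j) = K(j)`).  With `ValuativeBound` (`dim T_U(λ) ≥ K_m(λ*)`, stmt-12625, proved) the body of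
`ValuativeFlip` fails at the shape `μ♯(n+j)` for every admissible `(U, r)`: tail witnesses on
Kadish–Landsberg rays with `μ₂ ≤ n` must have an inner shape `μ` that is the type of an equation of the
inner determinant `Det_n` in degree `δ`.  Threshold-free form of `paddedPer_le_det_ray_of_eqFree_base`.
[BLMW 2011 §4.4, §6.4; this crux, k4 + k12 + k16] -/
theorem paddedPer_le_det_ray_of_eqFree_base_every (n δ : ℕ) [NeZero n] (μ : Nat.Partition (n * δ))
    (hμ : μ.parts.card ≤ n * n) (h₂ : μ.sortedParts.getD 1 0 ≤ n)
    (hfree : plethysmCoeff ℂ (MatIdx n) n (partitionWeightLex n μ) ≤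
      orbitMultiplicity ℂ (detFormLex ℂ n) n (partitionWeightLex n μ))
    (j : ℕ) [NeZero (n + j)] {n' : ℕ} (hn' : n' ≤ n + j) :
    orbitMultiplicity ℂ (paddedPerFormLex ℂ n' (n + j)) (n + j) (partitionWeightLex (n + j) (rowLift μ j)) ≤
      orbitMultiplicity ℂ (detFormLex ℂ (n + j)) (n + j) (partitionWeightLex (n + j) (rowLift μ j)) := by
  rw [det_ray_eq_plethysm_of_eqFree_base_every n δ μ hμ h₂ hfree j]
  exact orbitMultiplicity_le_plethysmCoeff_holds _ (NeZero.ne (n + j)) (paddedPerFormLex_isHomogeneous ℂ hn') _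

/-- **A ray flip forces a determinant equation at the base.**  Contrapositive, in the form the tail
programme uses: if `μ₂ ≤ n` and at some level `n + j` some padded permanent `X₀₀^{n+j-n'} per_{n'}` flips against
the determinant on the shape `μ♯(n+j)` — `K(j) < mult_{(μ♯)*} ℂ[Δ_{n+j}(X₀₀^{n+j-n'} per_{n'})]` — then `Det_n`
has an equation of type `μ*` in degree `δ` (`K_n(μ*) < a_μ(δ[n])`). [this crux, k4 + k12 + k16] -/
theorem det_base_lt_plethysm_of_ray_flip (n δ : ℕ) [NeZero n] (μ : Nat.Partition (n * δ))
    (hμ : μ.parts.card ≤ n * n) (h₂ : μ.sortedParts.getD 1 0 ≤ n) (j : ℕ) [NeZero (n + j)] {n' : ℕ}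
    (hn' : n' ≤ n + j)
    (hflip : orbitMultiplicity ℂ (detFormLex ℂ (n + j)) (n + j) (partitionWeightLex (n + j) (rowLift μ j)) <
      orbitMultiplicity ℂ (paddedPerFormLex ℂ n' (n + j)) (n + j) (partitionWeightLex (n + j) (rowLift μ j))) :
    orbitMultiplicity ℂ (detFormLex ℂ n) n (partitionWeightLex n μ) <
      plethysmCoeff ℂ (MatIdx n) n (partitionWeightLex n μ) := by
  by_contra hge
  rw [not_lt] at hge
  exact (lt_irrefl _) ((paddedPer_le_det_ray_of_eqFree_base_every n δ μ hμ h₂ hge j hn').trans_lt hflip)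

end

end Summit.ValiantsHypothesis.ValiantsHypothesis.Theorems.ValuativeFlip
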